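import Literature.Topology.FourManifolds.CuspGenericPoint
import Literature.Topology.FourManifolds.CuspCandidate
import Literature.Topology.FourManifolds.OneJetCriticalCurve
import HarnessLib

/-!
# Jets of a map in rank-one form `(t, w) ↦ (t, f(t, w))` and the genericity conditions read on `f`

Topic `Literature/Topology/FourManifolds` (programme of the fact
`Literature.Topology.FourManifolds.exists_isSimplifiedBrokenLefschetzFibration`, Baykur–Saeki 2017, §2.1).
By `RankOneNormalForm.exists_rankOne_charts`, near a point where `dF ≠ 0` a map
`F : ℝ⁴ → ℝ²` reads `y ↦ (y₀, f y)` in suitable charts (Golubitsky–Guillemin's coordinates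
`(†)` of VI §2, p. 147, one dimension up).  This file computes the jets of such a
**rank-one map** `OneJet.rankOneMap f : y ↦ y₀ e₀ + f(y) e₁` and translates the intrinsic
genericity conditions of the lane into conditions on `f` alone:

* `fderiv_rankOneMap`, `fderiv_fderiv_rankOneMap_apply`, `fderiv_fderiv_fderiv_rankOneMap_apply`
  — `dG = e₀ ⊗ dy₀ + e₁ ⊗ df`, `D²G = e₁ ⊗ D²f`, `D³G = e₁ ⊗ D³f`;
* `not_surjective_fderiv_rankOneMap_iff` — `y` is critical iff `df_y` kills the fibre
  `K₀ = {v | v₀ = 0}`; then `Ker dG_y = K₀` and `cokernelCovector f y = e₁* - (∂₀f) e₀*` spans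
  the cokernel, with `cokernelCovector f y (D²G(v, w)) = D²f(v, w)`;
* **`isCuspCandidateAt_rankOneMap_iff`** — cusp candidate iff critical and the fibre Hessian
  `D²f_y|_{K₀}` has a non-zero radical vector;
* **`isOneJetTransverseAt_rankOneMap_iff`** — at a critical point, `j¹G ⋔ S₁` iff no non-zero
  `k ∈ K₀` has `D²f_y(v, k) = 0` for all `v ∈ ℝ⁴`;
* **`isCuspGenericAt_rankOneMap_iff`** — at a critical point, cusp-generic iff every non-zero
  radical vector `k₀` of the fibre Hessian has `D³f_y(k₀, k₀, k₀) ≠ 0` (with the multiplier datum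
  `μ = e₀*`, `τ = -D²f_y(e₀, k₀)` the `μ`-term of Whitney's cubic vanishes) — the form in which
  Golubitsky–Guillemin state the simple-cusp condition (VI §2, proof of Thm. 2.4:
  `∂³h/∂x₂³ ≠ 0`).

Everything is proved; `rankOneMap` and `cokernelCovector` are the only definitions; no named
fact (D-0026).

## References

* M. Golubitsky, V. Guillemin, *Stable Mappings and Their Singularities*, GTM 14 (1973), Ch. VI
  §1–§2 (coordinates `(†)`, (2.1), Def. 2.3, proof of Thm. 2.4). [GolubitskyGuillemin1973]
* R. İ. Baykur, O. Saeki, *Simplifying indefinite fibrations on 4-manifolds*, arXiv:1705.11169,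
  §2.1, p. 6. [BaykurSaeki2017]
-/

noncomputable section

set_option maxSynthPendingDepth 2

open Set Function Filter
open scoped ContDiff Topology

namespace Literature.Topology.FourManifolds

namespace OneJet

section

/-- Local notation for this file: the model space `ℝⁿ = EuclideanSpace ℝ (Fin n)`. -/
local notation "𝔼 " n:arg => EuclideanSpace ℝ (Fin n)

/-- Local notation: the coordinate covectors of `ℝ⁴` and `ℝ²`. -/
local notation "π₄" => (EuclideanSpace.proj (𝕜 := ℝ) (ι := Fin 4))
local notation "π₂" => (EuclideanSpace.proj (𝕜 := ℝ) (ι := Fin 2))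

/-! ### The rank-one map and its jets -/

/-- **A map in rank-one form**: `G(y) = (y₀, f y) = y₀ e₀ + f(y) e₁`.
[cite: GolubitskyGuillemin1973, Ch. VI §2, (†) p. 147] -/
def rankOneMap (f : 𝔼 4 → ℝ) : 𝔼 4 → 𝔼 2 :=
  fun y => (y 0) • EuclideanSpace.single (0 : Fin 2) (1 : ℝ) +
    f y • EuclideanSpace.single (1 : Fin 2) (1 : ℝ)

/-- Unfolding `rankOneMap`. [folklore] -/
theorem rankOneMap_apply (f : 𝔼 4 → ℝ) (y : 𝔼 4) :
    rankOneMap f y = (y 0) • EuclideanSpace.single (0 : Fin 2) (1 : ℝ) +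
      f y • EuclideanSpace.single (1 : Fin 2) (1 : ℝ) := rfl

/-- The components of the rank-one map. [folklore] -/
@[simp]
theorem rankOneMap_apply_zero (f : 𝔼 4 → ℝ) (y : 𝔼 4) : rankOneMap f y 0 = y 0 := by
  simp [rankOneMap_apply]

/-- The components of the rank-one map. [folklore] -/
@[simp]
theorem rankOneMap_apply_one (f : 𝔼 4 → ℝ) (y : 𝔼 4) : rankOneMap f y 1 = f y := by
  simp [rankOneMap_apply]

/-- The linear part `v ↦ v₀ e₀` of the rank-one map. [folklore] -/
def baseL : 𝔼 4 →L[ℝ] 𝔼 2 :=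
  (π₄ 0).smulRight (EuclideanSpace.single (0 : Fin 2) (1 : ℝ))

/-- `baseL v = v₀ e₀`. [folklore] -/
@[simp]
theorem baseL_apply (v : 𝔼 4) : baseL v = (v 0) • EuclideanSpace.single (0 : Fin 2) (1 : ℝ) :=
  rfl

/-- The rank-one embedding `φ ↦ e₁ ⊗ φ` of covectors into `Hom(ℝ⁴, ℝ²)`. [folklore] -/
def liftL : (𝔼 4 →L[ℝ] ℝ) →L[ℝ] (𝔼 4 →L[ℝ] 𝔼 2) :=
  (ContinuousLinearMap.smulRightL ℝ (𝔼 4) (𝔼 2)).flip (EuclideanSpace.single (1 : Fin 2) (1 : ℝ))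

/-- `liftL φ v = φ v • e₁`. [folklore] -/
@[simp]
theorem liftL_apply (φ : 𝔼 4 →L[ℝ] ℝ) (v : 𝔼 4) :
    liftL φ v = φ v • EuclideanSpace.single (1 : Fin 2) (1 : ℝ) := by
  simp [liftL]

/-- **The differential of the rank-one map**: `dG_y = e₀ ⊗ dy₀ + e₁ ⊗ df_y`. [folklore] -/
theorem hasFDerivAt_rankOneMap {f : 𝔼 4 → ℝ} {y : 𝔼 4} {f' : 𝔼 4 →L[ℝ] ℝ}
    (hf : HasFDerivAt f f' y) : HasFDerivAt (rankOneMap f) (baseL + liftL f') y := by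
  have h1 : HasFDerivAt (fun y : 𝔼 4 => (y 0) • EuclideanSpace.single (0 : Fin 2) (1 : ℝ))
      baseL y := baseL.hasFDerivAt
  have h2 : HasFDerivAt (fun y : 𝔼 4 => f y • EuclideanSpace.single (1 : Fin 2) (1 : ℝ))
      (liftL f') y := by
    have h := hf.smul_const (EuclideanSpace.single (1 : Fin 2) (1 : ℝ))
    refine h.congr_fderiv ?_
    ext v i
    simp
  exact h1.add h2

/-- `fderiv` of the rank-one map at a point of differentiability. [folklore] -/
theorem fderiv_rankOneMap {f : 𝔼 4 → ℝ} {y : 𝔼 4} (hf : DifferentiableAt ℝ f y) :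
    fderiv ℝ (rankOneMap f) y = baseL + liftL (fderiv ℝ f y) :=
  (hasFDerivAt_rankOneMap hf.hasFDerivAt).fderiv

/-- `dG_y v = v₀ e₀ + df_y(v) e₁`. [folklore] -/
theorem fderiv_rankOneMap_apply {f : 𝔼 4 → ℝ} {y : 𝔼 4} (hf : DifferentiableAt ℝ f y)
    (v : 𝔼 4) :
    fderiv ℝ (rankOneMap f) y v = (v 0) • EuclideanSpace.single (0 : Fin 2) (1 : ℝ) +
      fderiv ℝ f y v • EuclideanSpace.single (1 : Fin 2) (1 : ℝ) := by
  rw [fderiv_rankOneMap hf]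
  simp

/-- `2 ≤ ∞`, `3 ≤ ∞` in `WithTop ℕ∞`. [folklore] -/
private theorem two_le_infty₂ : (2 : WithTop ℕ∞) ≤ ∞ := WithTop.coe_le_coe.2 le_top

variable {f : 𝔼 4 → ℝ} {Ω : Set (𝔼 4)}

/-- The rank-one map is `C^∞` where `f` is. [folklore] -/
theorem contDiffOn_rankOneMap (hf : ContDiffOn ℝ ∞ f Ω) : ContDiffOn ℝ ∞ (rankOneMap f) Ω :=
  ((π₄ 0).contDiff.smul contDiff_const).contDiffOn.add (hf.smul contDiffOn_const)

/-- On an open set of smoothness, `dG = baseL + liftL ∘ df`. [folklore] -/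
theorem fderiv_rankOneMap_eqOn (hΩ : IsOpen Ω) (hf : ContDiffOn ℝ ∞ f Ω) :
    EqOn (fderiv ℝ (rankOneMap f)) (fun y => baseL + liftL (fderiv ℝ f y)) Ω := fun y hy =>
  fderiv_rankOneMap ((hf.contDiffAt (hΩ.mem_nhds hy)).differentiableAt (by simp))

/-- **The second differential of the rank-one map**: `D²G_y = liftL ∘ D²f_y`, i.e.
`D²G_y(v, w) = D²f_y(v, w) e₁`. [folklore] -/
theorem fderiv_fderiv_rankOneMap (hΩ : IsOpen Ω) (hf : ContDiffOn ℝ ∞ f Ω) {y : 𝔼 4}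
    (hy : y ∈ Ω) :
    fderiv ℝ (fderiv ℝ (rankOneMap f)) y = liftL.comp (fderiv ℝ (fderiv ℝ f) y) := by
  have heq : fderiv ℝ (rankOneMap f) =ᶠ[𝓝 y] fun y => baseL + liftL (fderiv ℝ f y) :=
    eventuallyEq_of_mem (hΩ.mem_nhds hy) (fderiv_rankOneMap_eqOn hΩ hf)
  rw [heq.fderiv_eq]
  have hf' : ContDiffOn ℝ ∞ (fderiv ℝ f) Ω := hf.fderiv_of_isOpen hΩ (by simp)
  have hd : HasFDerivAt (fderiv ℝ f) (fderiv ℝ (fderiv ℝ f) y) y :=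
    ((hf'.contDiffAt (hΩ.mem_nhds hy)).differentiableAt (by simp)).hasFDerivAt
  exact ((liftL.hasFDerivAt.comp y hd).const_add baseL).fderiv

/-- `D²G_y(v, w) = D²f_y(v, w) e₁`. [folklore] -/
theorem fderiv_fderiv_rankOneMap_apply (hΩ : IsOpen Ω) (hf : ContDiffOn ℝ ∞ f Ω) {y : 𝔼 4}
    (hy : y ∈ Ω) (v w : 𝔼 4) :
    fderiv ℝ (fderiv ℝ (rankOneMap f)) y v w =
      fderiv ℝ (fderiv ℝ f) y v w • EuclideanSpace.single (1 : Fin 2) (1 : ℝ) := by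
  rw [fderiv_fderiv_rankOneMap hΩ hf hy]
  simp

/-- **The third differential of the rank-one map**: `D³G_y(u, v, w) = D³f_y(u, v, w) e₁`.
[folklore] -/
theorem fderiv_fderiv_fderiv_rankOneMap_apply (hΩ : IsOpen Ω) (hf : ContDiffOn ℝ ∞ f Ω)
    {y : 𝔼 4} (hy : y ∈ Ω) (u v w : 𝔼 4) :
    fderiv ℝ (fderiv ℝ (fderiv ℝ (rankOneMap f))) y u v w =
      fderiv ℝ (fderiv ℝ (fderiv ℝ f)) y u v w • EuclideanSpace.single (1 : Fin 2) (1 : ℝ) := by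
  set L₂ : (𝔼 4 →L[ℝ] 𝔼 4 →L[ℝ] ℝ) →L[ℝ] (𝔼 4 →L[ℝ] 𝔼 4 →L[ℝ] 𝔼 2) :=
    ContinuousLinearMap.compL ℝ (𝔼 4) (𝔼 4 →L[ℝ] ℝ) (𝔼 4 →L[ℝ] 𝔼 2) liftL with hL₂
  have heq : fderiv ℝ (fderiv ℝ (rankOneMap f)) =ᶠ[𝓝 y]
      fun y => L₂ (fderiv ℝ (fderiv ℝ f) y) := by
    filter_upwards [hΩ.mem_nhds hy] with z hz
    rw [fderiv_fderiv_rankOneMap hΩ hf hz, hL₂, ContinuousLinearMap.compL_apply]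
  rw [heq.fderiv_eq]
  have hf' : ContDiffOn ℝ ∞ (fderiv ℝ f) Ω := hf.fderiv_of_isOpen hΩ (by simp)
  have hf'' : ContDiffOn ℝ ∞ (fderiv ℝ (fderiv ℝ f)) Ω := hf'.fderiv_of_isOpen hΩ (by simp)
  have hd : HasFDerivAt (fderiv ℝ (fderiv ℝ f)) (fderiv ℝ (fderiv ℝ (fderiv ℝ f)) y) y :=
    ((hf''.contDiffAt (hΩ.mem_nhds hy)).differentiableAt (by simp)).hasFDerivAt
  have h3 : HasFDerivAt (fun y => L₂ (fderiv ℝ (fderiv ℝ f) y))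
      (L₂.comp (fderiv ℝ (fderiv ℝ (fderiv ℝ f)) y)) y := L₂.hasFDerivAt.comp y hd
  rw [h3.fderiv]
  simp [hL₂, ContinuousLinearMap.compL_apply]

/-! ### Critical points, kernel and cokernel -/

/-- `dG_y ≠ 0` (its `e₀`-component is `dy₀`). [folklore] -/
theorem fderiv_rankOneMap_ne_zero {y : 𝔼 4} (hf : DifferentiableAt ℝ f y) :
    fderiv ℝ (rankOneMap f) y ≠ 0 := by
  intro h
  have := congrArg (fun φ : 𝔼 4 →L[ℝ] 𝔼 2 => φ (EuclideanSpace.single (0 : Fin 4) (1 : ℝ)) 0) h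
  rw [fderiv_rankOneMap_apply hf] at this
  simp at this

/-- **Critical points of the rank-one map**: `dG_y` is not onto iff `df_y` vanishes on the
fibre `K₀ = {v | v₀ = 0}`. [folklore] -/
theorem not_surjective_fderiv_rankOneMap_iff {y : 𝔼 4} (hf : DifferentiableAt ℝ f y) :
    ¬ Surjective (fderiv ℝ (rankOneMap f) y) ↔ ∀ v : 𝔼 4, v 0 = 0 → fderiv ℝ f y v = 0 := by
  constructor
  · intro hns v hv0
    by_contra hv
    apply hns
    -- `dG e₀ = e₀ + c e₁` and `dG v = (df v) e₁` span `ℝ²`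
    intro w
    set e0 : 𝔼 4 := EuclideanSpace.single (0 : Fin 4) (1 : ℝ) with he0
    refine ⟨(w 0) • e0 + ((w 1 - (w 0) * fderiv ℝ f y e0) / fderiv ℝ f y v) • v, ?_⟩
    rw [map_add, map_smul, map_smul, fderiv_rankOneMap_apply hf, fderiv_rankOneMap_apply hf, hv0]
    ext i
    fin_cases i
    · simp [he0]
    · simp [he0]
      field_simp
      ring
  · intro hK hsurj
    obtain ⟨v, hv⟩ := hsurj (EuclideanSpace.single (1 : Fin 2) (1 : ℝ))
    have h0 : v 0 = 0 := by
      have := congrArg (fun w : 𝔼 2 => w 0) hv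
      rw [fderiv_rankOneMap_apply hf] at this
      simpa using this
    have h1 := congrArg (fun w : 𝔼 2 => w 1) hv
    rw [fderiv_rankOneMap_apply hf, hK v h0] at h1
    simp at h1

/-- **The kernel at a critical point** is the fibre `K₀ = {v | v₀ = 0}`. [folklore] -/
theorem fderiv_rankOneMap_apply_eq_zero_iff {y : 𝔼 4} (hf : DifferentiableAt ℝ f y)
    (hcrit : ∀ v : 𝔼 4, v 0 = 0 → fderiv ℝ f y v = 0) (v : 𝔼 4) :
    fderiv ℝ (rankOneMap f) y v = 0 ↔ v 0 = 0 := by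
  rw [fderiv_rankOneMap_apply hf]
  constructor
  · intro h
    have := congrArg (fun w : 𝔼 2 => w 0) h
    simpa using this
  · intro h0
    rw [h0, hcrit v h0, zero_smul, zero_smul, add_zero]

/-- **The cokernel covector** of the rank-one map at `y`: `e₁* - (∂₀ f)(y) e₀*`.
[cite: GolubitskyGuillemin1973, Ch. VI §2, (†) p. 147] -/
def cokernelCovector (f : 𝔼 4 → ℝ) (y : 𝔼 4) : (𝔼 2) →L[ℝ] ℝ :=
  π₂ 1 - fderiv ℝ f y (EuclideanSpace.single (0 : Fin 4) (1 : ℝ)) • π₂ 0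

/-- `cokernelCovector f y w = w₁ - ∂₀f(y) w₀`. [folklore] -/
@[simp]
theorem cokernelCovector_apply (f : 𝔼 4 → ℝ) (y : 𝔼 4) (w : 𝔼 2) :
    cokernelCovector f y w = w 1 - fderiv ℝ f y (EuclideanSpace.single (0 : Fin 4) (1 : ℝ)) * w 0 := by
  simp [cokernelCovector]

/-- The cokernel covector is non-zero (value `1` on `e₁`). [folklore] -/
theorem cokernelCovector_ne_zero (f : 𝔼 4 → ℝ) (y : 𝔼 4) : cokernelCovector f y ≠ 0 := by
  intro h
  have := congrArg (fun φ : (𝔼 2) →L[ℝ] ℝ => φ (EuclideanSpace.single (1 : Fin 2) (1 : ℝ))) h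
  simp at this

/-- A vector of `ℝ⁴` is its `e₀`-component plus a fibre vector. [folklore] -/
theorem eq_smul_single_add (v : 𝔼 4) :
    ∃ v' : 𝔼 4, v' 0 = 0 ∧ v = (v 0) • EuclideanSpace.single (0 : Fin 4) (1 : ℝ) + v' :=
  ⟨v - (v 0) • EuclideanSpace.single (0 : Fin 4) (1 : ℝ), by simp, by abel⟩

/-- At a critical point `df_y(v) = v₀ ∂₀f(y)`. [folklore] -/
theorem fderiv_apply_eq_of_critical {y : 𝔼 4} (hcrit : ∀ v : 𝔼 4, v 0 = 0 → fderiv ℝ f y v = 0)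
    (v : 𝔼 4) :
    fderiv ℝ f y v = v 0 * fderiv ℝ f y (EuclideanSpace.single (0 : Fin 4) (1 : ℝ)) := by
  obtain ⟨v', hv', hv⟩ := eq_smul_single_add v
  conv_lhs => rw [hv]
  rw [map_add, map_smul, hcrit v' hv', add_zero, smul_eq_mul]

/-- **At a critical point the cokernel covector annihilates the image of `dG_y`.** [folklore] -/
theorem cokernelCovector_comp_fderiv {y : 𝔼 4} (hf : DifferentiableAt ℝ f y)
    (hcrit : ∀ v : 𝔼 4, v 0 = 0 → fderiv ℝ f y v = 0) :
    (cokernelCovector f y).comp (fderiv ℝ (rankOneMap f) y) = 0 := by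
  ext v
  rw [ContinuousLinearMap.comp_apply, fderiv_rankOneMap_apply hf, cokernelCovector_apply,
    fderiv_apply_eq_of_critical hcrit v]
  simp [mul_comm]

/-- Every cokernel covector at a critical point is a multiple of `cokernelCovector f y`.
[folklore] -/
theorem exists_eq_smul_cokernelCovector {y : 𝔼 4} (hf : DifferentiableAt ℝ f y)
    (hcrit : ∀ v : 𝔼 4, v 0 = 0 → fderiv ℝ f y v = 0) {ℓ : (𝔼 2) →L[ℝ] ℝ}
    (hℓ : ℓ.comp (fderiv ℝ (rankOneMap f) y) = 0) :
    ∃ a : ℝ, ℓ = a • cokernelCovector f y := by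
  set m : 𝔼 2 := fderiv ℝ (rankOneMap f) y (EuclideanSpace.single (0 : Fin 4) (1 : ℝ)) with hm
  have hm0 : m ≠ 0 := by
    intro h
    have := congrArg (fun w : 𝔼 2 => w 0) h
    rw [hm, fderiv_rankOneMap_apply hf] at this
    simp at this
  have h0 : cokernelCovector f y m = 0 := by
    have := congrArg (fun φ : 𝔼 4 →L[ℝ] ℝ => φ (EuclideanSpace.single (0 : Fin 4) (1 : ℝ)))
      (cokernelCovector_comp_fderiv hf hcrit)
    simpa [hm] using this
  have hℓm : ℓ m = 0 := by
    have := congrArg (fun φ : 𝔼 4 →L[ℝ] ℝ => φ (EuclideanSpace.single (0 : Fin 4) (1 : ℝ))) hℓ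
    simpa [hm] using this
  exact exists_eq_smul_covector (cokernelCovector_ne_zero f y) h0 hm0 hℓm

/-- **The kernel Hessian pairing in rank-one form**: `cokernelCovector f y (D²G_y(v, w)) =
D²f_y(v, w)`. [folklore] -/
theorem cokernelCovector_fderiv_fderiv_rankOneMap (hΩ : IsOpen Ω) (hf : ContDiffOn ℝ ∞ f Ω)
    {y : 𝔼 4} (hy : y ∈ Ω) (v w : 𝔼 4) :
    cokernelCovector f y (fderiv ℝ (fderiv ℝ (rankOneMap f)) y v w) =
      fderiv ℝ (fderiv ℝ f) y v w := by
  rw [fderiv_fderiv_rankOneMap_apply hΩ hf hy, cokernelCovector_apply]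
  simp

/-- `cokernelCovector f y (D³G_y(u, v, w)) = D³f_y(u, v, w)`. [folklore] -/
theorem cokernelCovector_fderiv_fderiv_fderiv_rankOneMap (hΩ : IsOpen Ω)
    (hf : ContDiffOn ℝ ∞ f Ω) {y : 𝔼 4} (hy : y ∈ Ω) (u v w : 𝔼 4) :
    cokernelCovector f y (fderiv ℝ (fderiv ℝ (fderiv ℝ (rankOneMap f))) y u v w) =
      fderiv ℝ (fderiv ℝ (fderiv ℝ f)) y u v w := by
  rw [fderiv_fderiv_fderiv_rankOneMap_apply hΩ hf hy, cokernelCovector_apply]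
  simp

/-- `e₀* (D²G_y(v, w)) = 0`. [folklore] -/
theorem proj_zero_fderiv_fderiv_rankOneMap (hΩ : IsOpen Ω) (hf : ContDiffOn ℝ ∞ f Ω)
    {y : 𝔼 4} (hy : y ∈ Ω) (v w : 𝔼 4) :
    (π₂ 0) (fderiv ℝ (fderiv ℝ (rankOneMap f)) y v w) = 0 := by
  rw [fderiv_fderiv_rankOneMap_apply hΩ hf hy]
  simp

/-! ### The genericity conditions read on `f` -/

/-- **Cusp candidates in rank-one form**: `y` is a cusp candidate of `G = (y₀, f)` iff `df_y`
kills the fibre `K₀ = {v | v₀ = 0}` and the fibre Hessian `D²f_y|_{K₀}` has a non-zero radical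
vector. [cite: GolubitskyGuillemin1973, Ch. VI §2, (2.1)(b)] -/
theorem isCuspCandidateAt_rankOneMap_iff (hΩ : IsOpen Ω) (hf : ContDiffOn ℝ ∞ f Ω) {y : 𝔼 4}
    (hy : y ∈ Ω) :
    IsCuspCandidateAt (rankOneMap f) y ↔
      (∀ v : 𝔼 4, v 0 = 0 → fderiv ℝ f y v = 0) ∧
        ∃ k₀ : 𝔼 4, k₀ ≠ 0 ∧ k₀ 0 = 0 ∧
          ∀ k : 𝔼 4, k 0 = 0 → fderiv ℝ (fderiv ℝ f) y k k₀ = 0 := by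
  have hfd : DifferentiableAt ℝ f y := (hf.contDiffAt (hΩ.mem_nhds hy)).differentiableAt (by simp)
  rw [isCuspCandidateAt_iff, not_surjective_fderiv_rankOneMap_iff hfd]
  refine and_congr_right fun hcrit => ?_
  have hker := fderiv_rankOneMap_apply_eq_zero_iff hfd hcrit
  constructor
  · intro h
    obtain ⟨k₀, hk₀0, hk₀, hrad⟩ := h _ (cokernelCovector_ne_zero f y)
      (cokernelCovector_comp_fderiv hfd hcrit)
    refine ⟨k₀, hk₀0, (hker k₀).1 hk₀, fun k hk => ?_⟩
    rw [← cokernelCovector_fderiv_fderiv_rankOneMap hΩ hf hy]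
    exact hrad k ((hker k).2 hk)
  · rintro ⟨k₀, hk₀0, hk₀, hrad⟩ ℓ hℓ hℓG
    obtain ⟨a, rfl⟩ := exists_eq_smul_cokernelCovector hfd hcrit hℓG
    refine ⟨k₀, hk₀0, (hker k₀).2 hk₀, fun k hk => ?_⟩
    rw [_root_.smul_apply, cokernelCovector_fderiv_fderiv_rankOneMap hΩ hf hy,
      hrad k ((hker k).1 hk), smul_zero]

/-- **1-jet transversality in rank-one form** (at a critical point): `j¹G ⋔ S₁` at `y` iff no
non-zero fibre vector `k ∈ K₀` has `D²f_y(v, k) = 0` for all `v ∈ ℝ⁴`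
(Golubitsky–Guillemin's `d(∂h/∂x₂)₀ ≠ 0`, proof of VI Thm. 2.4).
[cite: GolubitskyGuillemin1973, Ch. VI §1, Def. 1.5; §2, proof of Thm. 2.4] -/
theorem isOneJetTransverseAt_rankOneMap_iff (hΩ : IsOpen Ω) (hf : ContDiffOn ℝ ∞ f Ω) {y : 𝔼 4}
    (hy : y ∈ Ω) (hcrit : ∀ v : 𝔼 4, v 0 = 0 → fderiv ℝ f y v = 0) :
    IsOneJetTransverseAt (rankOneMap f) y ↔
      ∀ k : 𝔼 4, k 0 = 0 → (∀ v : 𝔼 4, fderiv ℝ (fderiv ℝ f) y v k = 0) → k = 0 := by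
  have hfd : DifferentiableAt ℝ f y := (hf.contDiffAt (hΩ.mem_nhds hy)).differentiableAt (by simp)
  have hker := fderiv_rankOneMap_apply_eq_zero_iff hfd hcrit
  rw [isOneJetTransverseAt_iff]
  constructor
  · intro h k hk hv
    refine h _ (cokernelCovector_ne_zero f y) (cokernelCovector_comp_fderiv hfd hcrit) k
      ((hker k).2 hk) fun v => ?_
    rw [cokernelCovector_fderiv_fderiv_rankOneMap hΩ hf hy]
    exact hv v
  · intro h ℓ hℓ hℓG k hk hv
    obtain ⟨a, rfl⟩ := exists_eq_smul_cokernelCovector hfd hcrit hℓG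
    have ha : a ≠ 0 := by
      rintro rfl
      exact hℓ (zero_smul _ _)
    refine h k ((hker k).1 hk) fun v => ?_
    have h1 := hv v
    rw [_root_.smul_apply, cokernelCovector_fderiv_fderiv_rankOneMap hΩ hf hy,
      smul_eq_mul, mul_eq_zero] at h1
    exact h1.resolve_left ha

/-- The multiplier relation in rank-one form: for a radical vector `k₀` of the fibre Hessian,
`a D²f_y(v, k₀) = -τ e₀*(dG_y v)` with `τ = -a D²f_y(e₀, k₀)`. [folklore] -/
theorem multiplier_rankOneMap (hΩ : IsOpen Ω) (hf : ContDiffOn ℝ ∞ f Ω) {y : 𝔼 4} (hy : y ∈ Ω)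
    {k₀ : 𝔼 4} (hrad : ∀ k : 𝔼 4, k 0 = 0 → fderiv ℝ (fderiv ℝ f) y k k₀ = 0) (a : ℝ)
    (v : 𝔼 4) :
    (a • cokernelCovector f y) (fderiv ℝ (fderiv ℝ (rankOneMap f)) y v k₀) =
      -(-(a * fderiv ℝ (fderiv ℝ f) y (EuclideanSpace.single (0 : Fin 4) (1 : ℝ)) k₀) *
        (π₂ 0) (fderiv ℝ (rankOneMap f) y v)) := by
  have hfd : DifferentiableAt ℝ f y := (hf.contDiffAt (hΩ.mem_nhds hy)).differentiableAt (by simp)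
  obtain ⟨v', hv', hv⟩ := eq_smul_single_add v
  rw [_root_.smul_apply, cokernelCovector_fderiv_fderiv_rankOneMap hΩ hf hy,
    fderiv_rankOneMap_apply hfd]
  conv_lhs => rw [hv]
  rw [map_add, map_smul, _root_.add_apply, _root_.smul_apply, hrad v' hv', add_zero]
  simp
  ring

/-- **Cusp-genericity in rank-one form** (at a critical point where `j¹G ⋔ S₁`): `G = (y₀, f)`
is cusp-generic at `y` iff every non-zero radical vector `k₀ ∈ K₀` of the fibre Hessian has
`D³f_y(k₀, k₀, k₀) ≠ 0` — Whitney's simple-cusp condition `∂³h/∂x₂³ ≠ 0`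
(Golubitsky–Guillemin VI Def. 2.3 / proof of Thm. 2.4); the `μ`-term of the cubic vanishes for
the multiplier datum `μ = e₀*`. [cite: GolubitskyGuillemin1973, Ch. VI §2, Def. 2.3] -/
theorem isCuspGenericAt_rankOneMap_iff (hΩ : IsOpen Ω) (hf : ContDiffOn ℝ ∞ f Ω) {y : 𝔼 4}
    (hy : y ∈ Ω) (hcrit : ∀ v : 𝔼 4, v 0 = 0 → fderiv ℝ f y v = 0) :
    IsCuspGenericAt (rankOneMap f) y ↔
      ∀ k₀ : 𝔼 4, k₀ ≠ 0 → k₀ 0 = 0 →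
        (∀ k : 𝔼 4, k 0 = 0 → fderiv ℝ (fderiv ℝ f) y k k₀ = 0) →
          fderiv ℝ (fderiv ℝ (fderiv ℝ f)) y k₀ k₀ k₀ ≠ 0 := by
  have hfd : DifferentiableAt ℝ f y := (hf.contDiffAt (hΩ.mem_nhds hy)).differentiableAt (by simp)
  have hker := fderiv_rankOneMap_apply_eq_zero_iff hfd hcrit
  have hne := fderiv_rankOneMap_ne_zero (f := f) hfd
  -- the cubic for the covector `a ℓ_f` and the multiplier datum `(e₀*, τ)`
  have hcubic : ∀ (a : ℝ) (k₀ : 𝔼 4) (τ : ℝ),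
      cubicForm (rankOneMap f) y (a • cokernelCovector f y) (π₂ 0) k₀ τ =
        a * fderiv ℝ (fderiv ℝ (fderiv ℝ f)) y k₀ k₀ k₀ := by
    intro a k₀ τ
    rw [cubicForm_def, _root_.smul_apply,
      cokernelCovector_fderiv_fderiv_fderiv_rankOneMap hΩ hf hy,
      proj_zero_fderiv_fderiv_rankOneMap hΩ hf hy, mul_zero, add_zero, smul_eq_mul]
  rw [isCuspGenericAt_iff]
  constructor
  · intro h k₀ hk₀0 hk₀ hrad
    have h1 := h _ (by simpa using cokernelCovector_ne_zero f y)
      (by rw [ContinuousLinearMap.smul_comp, cokernelCovector_comp_fderiv hfd hcrit, smul_zero])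
      k₀ hk₀0 ((hker k₀).2 hk₀)
      (fun k hk => by
        rw [_root_.smul_apply, cokernelCovector_fderiv_fderiv_rankOneMap hΩ hf hy,
          hrad k ((hker k).1 hk), smul_zero])
      (π₂ 0) _ (multiplier_rankOneMap hΩ hf hy hrad 1)
    rwa [hcubic, one_mul] at h1
  · intro h ℓ hℓ hℓG k hk0 hk hrad μ τ hrel
    obtain ⟨a, rfl⟩ := exists_eq_smul_cokernelCovector hfd hcrit hℓG
    have ha : a ≠ 0 := by
      rintro rfl
      exact hℓ (zero_smul _ _)
    have hk' : k 0 = 0 := (hker k).1 hk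
    have hrad' : ∀ k' : 𝔼 4, k' 0 = 0 → fderiv ℝ (fderiv ℝ f) y k' k = 0 := by
      intro k' hk'0
      have h1 := hrad k' ((hker k').2 hk'0)
      rw [_root_.smul_apply, cokernelCovector_fderiv_fderiv_rankOneMap hΩ hf hy,
        smul_eq_mul, mul_eq_zero] at h1
      exact h1.resolve_left ha
    have h3 := h k hk0 hk' hrad'
    rw [cubicForm_eq_of_multiplier hne hℓ hℓG hk hrel (multiplier_rankOneMap hΩ hf hy hrad' a),
      hcubic]
    exact mul_ne_zero ha h3

end

end OneJet

end Literature.Topology.FourManifolds
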